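import Mathlib
import Summits.ValiantsHypothesis.ValiantsHypothesis.Theorems.NewtonUnitEquationsTwoProductsFormalLogLinearisationLiftedPencilCountBound
import HarnessLib

/-!
# Crux `TwoProducts` (stmt-ValiantsHypothesis-5906), line `relation_ladder` — R6 TOOL INTERFACE (val-idea-8 g3; rev 2: inline statement)

The exact statement the R6 rung (`RankOneLaw`, four-term shape `α + β = γ + δ`) consumes from the Hankel-tool lane
(desk RULING #266 (d): typer val-lit-p3 g14).  It generalises `ExpSum.pencilCount` (p595517) from pure monomial
characters `ν ↦ a^ν` to BINOMIAL characters `ν ↦ C(ν,d)·a^(ν-d)` (for `a = 0` this is the shifted indicator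
`[ν = d]`; for `d = 0` it is the pure character), with the bound quasi-polynomial in the BINOMIAL WIDTH
`N = Σ_k ∏_i (d k i + 1)` and polynomial in `s`.  Visibility is over ALL of `ℕ^s` exactly as in `ExpSum.pencilCount`
(no degree box).  Nothing here is proved; `BinExpPencilCount` is a `Prop` (the interface), not an axiom.
VP ≠ VNP is not moved by any of this. [folklore]
-/

noncomputable section

set_option linter.dupNamespace false

namespace Summit.ValiantsHypothesis.ValiantsHypothesis.Cruxes.TwoProducts.RelationLadder.R6Tool

open scoped BigOperators

/-- Binomial character `binChar a d ν = C(ν, d) · a ^ (ν - d)`; `binChar a 0 ν = a ^ ν`, `binChar 0 d ν = [ν = d]`. -/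
def binChar (a : ℂ) (d ν : ℕ) : ℂ := (Nat.choose ν d : ℂ) * a ^ (ν - d)

/-- A signed binomial-exponential sum on `ℕ^s` with term set `κ`:
`F(ν) = Σ_k c_k · ∏_i C(ν_i, d_{k i}) · a_{k i} ^ (ν_i - d_{k i})`. -/
def binExpSum {s : ℕ} {κ : Type*} [Fintype κ] (c : κ → ℂ) (a : κ → Fin s → ℂ) (d : κ → Fin s → ℕ)
    (ν : Fin s → ℕ) : ℂ :=
  ∑ k, c k * ∏ i, binChar (a k i) (d k i) (ν i)

/-- Binomial width `N = Σ_k ∏_i (d_{k i} + 1)` (= `|κ|` for pure characters). -/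
def binWidth {s : ℕ} {κ : Type*} [Fintype κ] (d : κ → Fin s → ℕ) : ℕ := ∑ k, ∏ i, (d k i + 1)

/-- **R6 TOOL INTERFACE `BinExpPencilCount` (rev 2: INLINE form — no auxiliary definition inside the statement, exactly as
`ExpSum.pencilCount` is stated, so that a Theorems-side theorem with this literal statement is consumed BY NAME).**
There is an absolute constant `A` such that for every signed binomial-exponential sum
`F(ν) = Σ_k c_k ∏_i C(ν_i, d_{k i}) a_{k i}^(ν_i − d_{k i})` on `ℕ^s` of binomial width `N = Σ_k ∏_i (d_{k i} + 1)` and every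
real pencil `u + t·v`, every finite set of points `μ` with `F μ ≠ 0`, each the STRICT `(u + t v)`-minimiser of `{F ≠ 0}` (over
all of `ℕ^s`) for some real `t`, has at most `(s + 2)^A · (N + 2)^(A · (log₂ (N + 2) + 1))` elements.
(`binExpPencilCount_iff` below: the same statement through `binExpSum` / `binWidth`.)
Expected proof: the three Hankel-tool ingredients with `|κ| ↦ N` — corner-cube support via `binChar a d 0 = [d = 0]`,
hyperbolic cross via the Pascal shift `(E - a) (binChar a (d+1)) = binChar a d`, slot rank via the Vandermonde
addition formula `binChar a d (x + y) = Σ_{i+j=d} binChar a i x · binChar a j y`. [folklore] -/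
def BinExpPencilCount : Prop :=
  ∃ A : ℕ, ∀ (s n : ℕ) (c : Fin n → ℂ) (a : Fin n → Fin s → ℂ) (d : Fin n → Fin s → ℕ) (u v : Fin s → ℝ)
    (S : Finset (Fin s → ℕ)),
    (∀ μ ∈ S, (∑ k, c k * ∏ i, ((μ i).choose (d k i) : ℂ) * a k i ^ (μ i - d k i)) ≠ 0 ∧
      ∃ t : ℝ, ∀ ν : Fin s → ℕ, ν ≠ μ →
        (∑ k, c k * ∏ i, ((ν i).choose (d k i) : ℂ) * a k i ^ (ν i - d k i)) ≠ 0 →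
        ∑ i, (u i + t * v i) * (μ i : ℝ) < ∑ i, (u i + t * v i) * (ν i : ℝ)) →
    S.card ≤ (s + 2) ^ A *
      (∑ k, ∏ i, (d k i + 1) + 2) ^ (A * (Nat.log 2 (∑ k, ∏ i, (d k i + 1) + 2) + 1))

/-- The interface through the named sums (definitionally the same statement). [folklore] -/
theorem binExpPencilCount_iff :
    BinExpPencilCount ↔
    ∃ A : ℕ, ∀ (s n : ℕ) (c : Fin n → ℂ) (a : Fin n → Fin s → ℂ) (d : Fin n → Fin s → ℕ) (u v : Fin s → ℝ)
      (S : Finset (Fin s → ℕ)),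
      (∀ μ ∈ S, binExpSum c a d μ ≠ 0 ∧ ∃ t : ℝ, ∀ ν : Fin s → ℕ, ν ≠ μ → binExpSum c a d ν ≠ 0 →
          ∑ i, (u i + t * v i) * (μ i : ℝ) < ∑ i, (u i + t * v i) * (ν i : ℝ)) →
      S.card ≤ (s + 2) ^ A * (binWidth d + 2) ^ (A * (Nat.log 2 (binWidth d + 2) + 1)) :=
  Iff.rfl

/-! Sanity: pure characters are the `d = 0` case; base `0` gives shifted indicators. -/

theorem binChar_zero_left (a : ℂ) (ν : ℕ) : binChar a 0 ν = a ^ ν := by simp [binChar]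

theorem binChar_base_zero (d ν : ℕ) : binChar 0 d ν = if ν = d then 1 else 0 := by
  unfold binChar
  rcases lt_trichotomy ν d with h | rfl | h
  · simp [Nat.choose_eq_zero_of_lt h, h.ne]
  · simp
  · simp [zero_pow (Nat.sub_ne_zero_of_lt h), h.ne']

theorem binExpSum_zero_degree {s : ℕ} {κ : Type*} [Fintype κ] (c : κ → ℂ) (a : κ → Fin s → ℂ)
    (ν : Fin s → ℕ) : binExpSum c a (fun _ _ => 0) ν = ∑ k, c k * ∏ i, a k i ^ ν i := by
  simp [binExpSum, binChar]

theorem binWidth_zero_degree {s : ℕ} {κ : Type*} [Fintype κ] :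
    binWidth (fun (_ : κ) (_ : Fin s) => 0) = Fintype.card κ := by
  simp [binWidth]

/-- Vandermonde addition formula for binomial characters (the slot-rank identity). [folklore] -/
theorem binChar_add (a : ℂ) (d x y : ℕ) :
    binChar a d (x + y) = ∑ ij ∈ Finset.HasAntidiagonal.antidiagonal d, binChar a ij.1 x * binChar a ij.2 y := by
  unfold binChar
  rw [Nat.add_choose_eq, Nat.cast_sum, Finset.sum_mul]
  refine Finset.sum_congr rfl fun ij hij => ?_
  have hd : ij.1 + ij.2 = d := Finset.HasAntidiagonal.mem_antidiagonal.1 hij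
  by_cases h1 : ij.1 ≤ x
  · by_cases h2 : ij.2 ≤ y
    · have : x + y - d = (x - ij.1) + (y - ij.2) := by omega
      rw [this, pow_add]; push_cast; ring
    · push Not at h2
      simp [Nat.choose_eq_zero_of_lt h2]
  · push Not at h1
    simp [Nat.choose_eq_zero_of_lt h1]

end Summit.ValiantsHypothesis.ValiantsHypothesis.Cruxes.TwoProducts.RelationLadder.R6Tool
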